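import Mathlib
import HarnessLib
import Literature.Analysis.FluidPDE.Tao2016AveragedNS.SplitCascadeFrame
import Summits.NavierStokesRegularity.NavierStokesRegularity.Theses.TaoLadderRungOne

/-!
# Stub `stub_splitWaveletData` of the birth skeleton of crux `SplitCascadeBlowup` (route TaoLadderRungOne)

HONEST FRAMING: a statement about wavelet data for Tao 2016's LOCAL CASCADE MODEL (J. Amer. Math.
Soc. 29 (2016), §4 p. 21); nothing here concerns the true Navier–Stokes equations, and nothing
here proves the crux.

The registered stub (item stmt-NavierStokesRegularity-19872, skeleton
`Cruxes/SplitCascadeBlowup/Lines/birth.lean` of planner theory-1 g3, stubs `stub_splitWaveletData`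
/ `stub_splitODEBlowup` / `stub_splitReduction`): for `0 < ε₀ ≤ 1` and every `m ≤ 9` there are
wavelet data in Tao's §4 sense on `m` modes (`Tao2016.CascadeWaveletData ε₀ m`: disjoint balls
`±Bᵢ` inside the annulus `{1 < |ξ| ≤ 1 + ε₀/2}`, real Schwartz divergence-free profiles with real
Fourier transforms supported on `Bᵢ ∪ -Bᵢ`, `‖ψᵢ‖_{L²} = 1`) whose balls have radius `≤ ε₀/128`
and whose centre MODULI are pairwise at least `ε₀/20` apart. PROVED from the tree's
`Tao2016.exists_cascadeWaveletData_norm_center` (p485573, `SplitCascadeFrame.lean`: wavelet data with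
ANY prescribed centre moduli in `(1, 1+ε₀/2)` and radius below any `r₀ > 0`) at the moduli
`ρᵢ = 1 + (i+1)ε₀/20`, `i < m ≤ 9` (so `ρᵢ ≤ 1 + 9ε₀/20 < 1 + ε₀/2`), radius `< ε₀/128`.
The hypothesis `ε₀ ≤ 1` of the registered signature is not needed and not used.

## References
* T. Tao, *Finite time blowup for an averaged three-dimensional Navier–Stokes equation*,
  J. Amer. Math. Soc. 29 (2016), 601–674 = arXiv:1402.0290v3, §4 p. 21 (wavelet data), §3.2 p. 15
  (distinct input magnitudes). [`Tao2016AveragedNS`]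
-/

noncomputable section

-- the sub-problem namespace `Summit.NavierStokesRegularity.NavierStokesRegularity` repeats the summit name by design (D-0017)
set_option linter.dupNamespace false

namespace Summit.NavierStokesRegularity.NavierStokesRegularity.Theorems.SplitCascadeBlowup.Birth

open Literature.Analysis.FluidPDE Literature.Analysis.FluidPDE.Tao2016

/-- The split moduli `ρᵢ = 1 + (i+1)ε₀/20` (`i < m ≤ 9`) lie in Tao's band `(1, 1 + ε₀/2)`.
[cite: Tao2016AveragedNS, §4 p. 21] -/
theorem splitModuli_mem {ε₀ : ℝ} (hε₀ : 0 < ε₀) {m : ℕ} (hm : m ≤ 9) (i : Fin m) :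
    1 < 1 + ((i : ℕ) + 1 : ℝ) * ε₀ / 20 ∧ 1 + ((i : ℕ) + 1 : ℝ) * ε₀ / 20 < 1 + ε₀ / 2 := by
  have hi : ((i : ℕ) : ℝ) + 1 ≤ 9 := by
    have : (i : ℕ) + 1 ≤ 9 := le_trans i.isLt hm
    exact_mod_cast this
  have hi0 : (0 : ℝ) ≤ (i : ℕ) := by positivity
  constructor
  · have : 0 < ((i : ℕ) + 1 : ℝ) * ε₀ / 20 := by positivity
    linarith
  · nlinarith

/-- Distinct split moduli are at least `ε₀/20` apart: `|ρᵢ - ρⱼ| = |i - j|·ε₀/20 ≥ ε₀/20` for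
`i ≠ j`. [cite: Tao2016AveragedNS, §3.2 p. 15] -/
theorem splitModuli_gap {ε₀ : ℝ} (hε₀ : 0 < ε₀) {m : ℕ} {i j : Fin m} (hij : i ≠ j) :
    ε₀ / 20 ≤ |(1 + ((i : ℕ) + 1 : ℝ) * ε₀ / 20) - (1 + ((j : ℕ) + 1 : ℝ) * ε₀ / 20)| := by
  have hne : ((i : ℕ) : ℝ) ≠ (j : ℕ) := by
    intro h; exact hij (Fin.ext (by exact_mod_cast h))
  have hdiff : (1 + ((i : ℕ) + 1 : ℝ) * ε₀ / 20) - (1 + ((j : ℕ) + 1 : ℝ) * ε₀ / 20) =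
      (((i : ℕ) : ℝ) - (j : ℕ)) * (ε₀ / 20) := by ring
  rw [hdiff, abs_mul, abs_of_pos (by positivity : (0 : ℝ) < ε₀ / 20)]
  have h1 : (1 : ℝ) ≤ |((i : ℕ) : ℝ) - (j : ℕ)| := by
    rcases lt_or_gt_of_ne hne with h | h
    · have : ((i : ℕ) : ℝ) + 1 ≤ (j : ℕ) := by
        exact_mod_cast (show (i : ℕ) < j by exact_mod_cast h)
      rw [abs_of_neg (by linarith)]; linarith
    · have : ((j : ℕ) : ℝ) + 1 ≤ (i : ℕ) := by
        exact_mod_cast (show (j : ℕ) < i by exact_mod_cast h)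
      rw [abs_of_pos (by linarith)]; linarith
  nlinarith

/-- **STUB `stub_splitWaveletData` (PROVED, registered signature)**: for `0 < ε₀ ≤ 1` and `m ≤ 9`
there are wavelet data in Tao's §4 sense on `m` modes whose frequency balls have radius `≤ ε₀/128`
and whose centre moduli are pairwise `≥ ε₀/20` apart (room: nine moduli `1 + (i+1)ε₀/20` inside
the band `(1, 1 + ε₀/2)`). From the tree's `Tao2016.exists_cascadeWaveletData_norm_center`.
[cite: Tao2016AveragedNS, §4 p. 21] -/
theorem stub_splitWaveletData :
    ∀ ε₀ : ℝ, 0 < ε₀ → ε₀ ≤ 1 → ∀ m : ℕ, m ≤ 9 →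
      ∃ 𝒟 : CascadeWaveletData ε₀ m, (∀ i, 𝒟.radius i ≤ ε₀ / 128) ∧
        ∀ i j, i ≠ j → ε₀ / 20 ≤ |‖𝒟.center i‖ - ‖𝒟.center j‖| := by
  intro ε₀ hε₀ _ m hm
  obtain ⟨𝒟, hc, hr⟩ := exists_cascadeWaveletData_norm_center
    (ε₀ := ε₀) (fun i : Fin m => 1 + ((i : ℕ) + 1 : ℝ) * ε₀ / 20) (splitModuli_mem hε₀ hm)
    (by positivity : (0 : ℝ) < ε₀ / 128)
  refine ⟨𝒟, fun i => (hr i).le, fun i j hij => ?_⟩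
  rw [hc i, hc j]
  exact splitModuli_gap hε₀ hij

end Summit.NavierStokesRegularity.NavierStokesRegularity.Theorems.SplitCascadeBlowup.Birth

end
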